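/-
SplitsliceCtrl.lean — crux workfile for `stmt-BirchSwinnertonDyer-20728`
(`SignedBaseChange.TwoVariableEulerSystemDivisibility`), idea `splitslice`, residual **CTRL_ℓ**
(v1.1, g42; v1.0 = §1–§5, v1.1 adds §6): the ALGEBRAIC SHADOW of the per-line control theorem —
how a `π`-semilinear restriction-dual `Φ : Y → X^{rel,str}_ℓ` along a line of the pencil becomes
the `O⟦T₁⟧`-linear control map `ctrl : Y/(T₂ - u)Y → X^{rel,str}_ℓ` (for door 5's `fibreSection`
structure) that `SplitsliceG4.fibreBoundAtPar_of_line` / `fibreBoundAt_of_line` consume, when it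
is a (pseudo-)isomorphism, and (§6) why door 5's fibre IS the base change of `X` along the
evaluation `θ_u : Λ₂ → S⟦T₁⟧` — so that the producer only owes a `θ_u`-semilinear map on `X`.

HONEST FRAMING. Nothing in this file proves the crux, the route, or BSD. It is a COMPANION of
`QtameDoor5.lean` v1.2 / `SplitsliceG4.lean` v1.1.1 / `SplitsliceG5red.lean` v1.3.2 (all published
on this item with `ledger crux write`); the skeleton of record `Lines/ratlift.lean` v5.4 is
untouched. What is PROVED here is module theory over an arbitrary commutative ring `O`
(resp. a DVR `O` in §4): NO Galois cohomology, NO Selmer group, NO elliptic curve is mentioned.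
The arithmetic producer of CTRL_ℓ (the twisted Greenberg control theorem along the line, see the
DICTIONARY) is NOT in the tree and is NOT claimed; this file isolates exactly what it has to
deliver (a semilinear surjection with kernel `(T₂ - u)Y`, or finite defects; since §6: a
`θ_u`-semilinear `φ : X → X^{rel,str}_ℓ` with finite defects) and certifies that this delivery is
what G4's `ctrl`/`hctrl` binders ask for.

DICTIONARY (intended instantiation, not asserted). `O = S = ℤ_p[ζ]`, `ζ` a primitive `p^n`-th root
of unity, `u = ζ - 1 ∈ 𝔪_S`; door 5's frame `(g₁, g₂)` adapted to the pencil (`g₂` a topological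
generator of `H = Gal(K̃_∞/K^{axis}_∞)`, `K^{axis}_∞ = K^{(v̄)}_∞` the Katz-axis `ℤ_p`-extension
unramified outside `v̄`, door 5 `PatchDirection.ofFrame`); `Y = Λ_{2,S} ⊗_{Λ₂} X_Gr₂` (door 5's
base change `FibreBoundOver`); the fibre `T₂ = u` is the line `ℓ(μ₀) = μ₀·Γ̂^{axis}` of pencil 1,
`μ₀(g₂) = ζ`, equivalently `(χ₀ ∘ Nm)·Γ̂^{axis}` for the unique cyclotomic torsion character `χ₀`
with `χ₀ ∘ Nm = μ₀` on `H` (`H ⊇ I_v ↠ Γ_K^{cyc}` is an isomorphism `ℤ_p ≅ ℤ_p`: `K^{cyc}_∞/K` is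
totally ramified at `v`). BASE-CHANGE / ORBIT FORM (typed in §6): door 5's fibre `Y/(T₂ - u)Y`
with its `fibreSection` structure IS the base change `S⟦T₁⟧ ⊗_{Λ₂,θ_u} X` along the evaluation
`θ_u : Λ₂ → S⟦T₁⟧`, `T₂ ↦ u` (universal property `existsUnique_factor`); when `S = ℤ_p[u]`, `θ_u`
is SURJECTIVE with kernel the height-one prime `P_u = (Φ_{p^n}(1 + T₂))` and the fibre is
`X/P_u X` (`toFibre_surjective`, `toFibre_eq_zero_of_mem`): CTRL_ℓ is Greenberg control for
`X_Gr₂` at the height-one prime `P_u` of `Λ₂` — no twisting language and no CRT between conjugate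
fibres needed. `π : S⟦T₂⟧⟦T₁⟧ → S⟦T₁⟧` is evaluation at `T₂ = u` (door 5's `ev₂ hu`; here ANY ring
map with `π ∘ fibreSection = id` and `π (T₂ - u) = 0`; §6b–§6d also use `ker π = (T₂ - u)`).
`Xrs` = the `S⟦T₁⟧`-module `X^{rel,str}_ℓ` = Pontryagin dual of the `μ₀⁻¹`-twisted Greenberg
Selmer group of `E` over `K^{axis}_∞` with coefficients in `S` (relaxed/strict at the two primes
above `p` as in `XGr₂ … vbar`); `Φ` = the dual of restriction `Sel(K^{axis}_∞, A ⊗ S(μ₀⁻¹)) →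
Sel(K̃_∞, A ⊗ S)[g₂ = ζ]` (classes of `K̃_∞` on which `g₂` acts by `ζ`), which is `π`-SEMILINEAR
because `g₂ - 1 ↦ T₂ ↦ u = ζ - 1`. CTRL_ℓ(μ₀) = «`Φ` is surjective and `ker Φ = (T₂ - u)Y`»
(exact control: inflation–restriction along `⟨g₂⟩ ≅ ℤ_p` — `H¹(⟨g₂⟩, E(K̃_∞)[p^∞] ⊗ μ₀⁻¹) = 0`
when `E(K)[p] = 0`, `H² = 0` since `cd_p ℤ_p = 1`; local conditions descend as in
`SplitsliceG5red` §8–§10, which is the case `u = 0`, `S = ℤ_p`), or its finite-defect form (§4),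
or (§6) «the `θ_u`-semilinear `φ : X → X^{rel,str}_ℓ` is onto with `ker φ ≤ P_u X` up to finite
defects». References for the arithmetic side: Greenberg, LNM 1716 (1999) §3–§4 (control);
Skinner–Urban, Invent. math. 195 (2014) §3.2.7–Prop. 3.2.8; Ochiai, Compos. Math. 142 (2006)
Lemma 7.2(b) (specialisation of two-variable Selmer duals at height-one primes);
Burungale–Skinner–Tian–Wan arXiv:2409.01350
Thm. 1.21 / §1.4.1 and Burungale–Castella–Skinner arXiv:2405.00270 Rem. 1.5.1 (where the
per-line Euler-system input KS_ℓ that G4 pairs with CTRL_ℓ is author-named: memo GN-CHECK-g42).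

WHAT IS PROVED (all `sorry`-free):
* §1 verbatim COPIES of door 5's fibre vocabulary (`verticalPrimeO`, `fibreSection`, `fibreModule`,
  `fibreCharIdeal`) — DEDUP NOTE: identical to `QtameDoor5` v1.2 §2 / `SplitsliceG4` §1 (Cruxes
  modules are not importable on the farm; the copies are definitionally equal, so every theorem
  below applies verbatim to G4's binders).
* §2 `ctrl π hsec hvan Φ` : the descent of a `π`-semilinear `Φ : Y →ₛₗ[π] Xrs` to an
  `O⟦T₁⟧`-LINEAR map `QuotSMulTop (verticalPrimeO O u) Y →ₗ[O⟦T₁⟧] Xrs` for `fibreModule O u Y`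
  (`ctrl_mk : ctrl [y] = Φ y`); `ctrl_surjective_iff` (`↔ Φ` surjective); `ctrl_injective_iff`
  (`↔ ker Φ ≤ (T₂ - u) • ⊤`); `range_ctrl` / `ker_ctrl` as sets.
* §3 EXACT CONTROL: `ctrlEquiv` (a linear equivalence when `Φ` is surjective with
  `ker Φ ≤ (T₂ - u)•⊤`), `isPseudoIsomorphism_ctrl` (G4's `hctrl` verbatim),
  `fibreCharIdeal_eq_of_exact` (`ch_{O⟦T₁⟧}(Y/(T₂-u)Y) = ch_{O⟦T₁⟧}(Xrs)`), and the
  `Ideal.span {T₂ - u} • ⊤` phrasing used by `SplitsliceG5red.ctrl₂_of_lcd` (`u = 0`).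
* §4 FINITE-DEFECT CONTROL over a DVR `O`: `isPseudoNull_of_finite` for `O⟦T⟧`-modules
  (`dim O⟦T⟧ ≥ 2`, so a prime of height `≤ 1` misses some `s ∈ 𝔪`; pigeonhole), hence
  `isPseudoIsomorphism_ctrl_of_finite`: finite `ker Φ/(T₂ - u)Y` and finite
  `Xrs/⟨range Φ⟩` suffice for G4's `hctrl`; `fibreCharIdeal_eq_of_finite`.
* §5 NON-VACUITY of the abstract evaluation: `π₀ = PowerSeries.map constantCoeff` (the point
  `u = 0`, `SplitsliceG5red.specT₂`) satisfies `hsec` and `hvan`.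
* §6 (v1.1) BASE CHANGE ALONG `θ_u` WITHOUT an `A`-structure on `O⟦T₁⟧` (which would clash with
  `PowerSeries.instAlgebra`): for any `[Algebra A O⟦T₂⟧⟦T₁⟧]` (door 5: `A = Λ₂`) and ring map
  `θ : A → O⟦T₁⟧` with `π ∘ algebraMap = θ` — 6a `baseLift φ : O⟦T₂⟧⟦T₁⟧ ⊗_A X →ₛₗ[π] Xrs`,
  `F ⊗ x ↦ π F • φ x`, from a `θ`-semilinear `φ : X →ₛₗ[θ] Xrs` (`baseLift_tmul`,
  `baseLift_surjective`, `span_range_baseLift`, `range_ctrl_baseLift`); 6b the `θ`-semilinear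
  structure map `toFibre : x ↦ [1 ⊗ x]`, `ctrl_baseLift_toFibre`
  (`ctrl (baseLift φ) ∘ toFibre = φ`), `span_range_toFibre`, `ext_on_toFibre` and the UNIVERSAL
  PROPERTY `existsUnique_factor` (the fibre with `toFibre` is the extension of scalars of `X`
  along `θ`); 6c
  `isPseudoIsomorphism_ctrl_baseLift_of_finite_ker` (any `S`; `O` a DVR); 6d ORBIT FORM for `θ`
  surjective: `toFibre_eq_zero_of_mem`, `toFibre_surjective`, `toFibreQ`,
  `mem_smul_top_of_baseLift_eq_zero`, `isPseudoIsomorphism_ctrl_baseLift_of_exact` /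
  `fibreCharIdeal_eq_of_baseLift_exact` (`φ` onto, `ker φ ≤ (ker θ)X`) and
  `isPseudoIsomorphism_ctrl_baseLift_of_finite` / `fibreCharIdeal_eq_of_baseLift_finite` (finite
  `ker φ/(ker θ)X` and `Xrs/⟨φ(X)⟩`).

References (module theory): N. Bourbaki, AC VII §4.4 (pseudo-null, pseudo-isomorphism) and
A II §5.1 (extension of scalars, universal property); L. C. Washington, GTM 83, §13.2; NSW (2008)
(5.1.4) Remark 4 (finite ⟹ pseudo-null).
No summit statement is proved by this file; BSD is not proved.
-/
import Literature.NumberTheory.EllipticCurves.IwasawaAlgebraPseudoNullProofs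
import Literature.NumberTheory.EllipticCurves.IwasawaAlgebraCharIdealProofs
import Literature.NumberTheory.EllipticCurves.IwasawaSelmerIsTorsionProofs
import Mathlib.RingTheory.QuotSMulTop
import Mathlib.RingTheory.KrullDimension.NonZeroDivisors
import Mathlib.RingTheory.KrullDimension.PID
import Mathlib.RingTheory.PowerSeries.Inverse
import HarnessLib

set_option linter.dupNamespace false
set_option autoImplicit false

noncomputable section

open scoped Pointwise

namespace Summit.BirchSwinnertonDyer.BirchSwinnertonDyer.Cruxes.TwoVariableEulerSystemDivisibility.SplitsliceCtrl

open Literature.NumberTheory.EllipticCurves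

/-! ## §1 Door-5 fibre vocabulary (verbatim copies of `QtameDoor5` v1.2 §2 = `SplitsliceG4` §1) -/

section Fibres

variable (O : Type*) [CommRing O]

/-- COPY of `QtameDoor5.verticalPrimeO` / `SplitsliceG4.verticalPrimeO`: the vertical prime
`T₂ - u` of `O⟦T₂⟧⟦T₁⟧` through the point `u` of the inner disc. [folklore] -/
def verticalPrimeO (u : O) : PowerSeries (PowerSeries O) :=
  PowerSeries.C (R := PowerSeries O) (PowerSeries.X - PowerSeries.C (R := O) u)

/-- COPY of `QtameDoor5.fibreSection` / `SplitsliceG4.fibreSection`: the section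
`O⟦T⟧ → O⟦T₂⟧⟦T₁⟧`, `T ↦ T₁`, constants to constants. [folklore] -/
def fibreSection : PowerSeries O →+* PowerSeries (PowerSeries O) :=
  PowerSeries.map (PowerSeries.C (R := O))

/-- COPY of `SplitsliceG4.fibreModule`: the `O⟦T₁⟧`-module structure of the fibre `Y/(T₂ - u)Y`
through `fibreSection`. [folklore] -/
abbrev fibreModule (u : O) (Y : Type*) [AddCommGroup Y] [Module (PowerSeries (PowerSeries O)) Y] :
    Module (PowerSeries O) (QuotSMulTop (verticalPrimeO O u) Y) :=
  Module.compHom _ (fibreSection O)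

/-- COPY of `SplitsliceG4.fibreCharIdeal`: `ch_{O⟦T₁⟧}(Y/(T₂ - u)Y)` for the `fibreSection`
structure. [folklore] -/
def fibreCharIdeal (u : O) (Y : Type*) [AddCommGroup Y] [Module (PowerSeries (PowerSeries O)) Y] :
    Ideal (PowerSeries O) :=
  letI : Module (PowerSeries O) (QuotSMulTop (verticalPrimeO O u) Y) := fibreModule O u Y
  Module.charIdeal (PowerSeries O) (QuotSMulTop (verticalPrimeO O u) Y)

end Fibres

/-! ## §2 Descent of a `π`-semilinear map to the fibre -/

section Descent

variable {O : Type*} [CommRing O] {u : O} (π : PowerSeries (PowerSeries O) →+* PowerSeries O)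
  (hsec : ∀ b, π (fibreSection O b) = b) (hvan : π (verticalPrimeO O u) = 0)

variable {Y Xrs : Type*} [AddCommGroup Y] [Module (PowerSeries (PowerSeries O)) Y]
  [AddCommGroup Xrs] [Module (PowerSeries O) Xrs]

include hvan in
/-- A `π`-semilinear map kills `(T₂ - u) • y` when `π (T₂ - u) = 0`. [folklore] -/
theorem map_verticalPrimeO_smul (Φ : Y →ₛₗ[π] Xrs) (y : Y) : Φ (verticalPrimeO O u • y) = 0 := by
  rw [LinearMap.map_smulₛₗ, hvan, zero_smul]

include hvan in
/-- `(T₂ - u) • Y ≤ ker Φ`. [folklore] -/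
theorem smul_top_le_ker (Φ : Y →ₛₗ[π] Xrs) :
    verticalPrimeO O u • (⊤ : Submodule (PowerSeries (PowerSeries O)) Y) ≤ LinearMap.ker Φ := by
  intro y hy
  obtain ⟨y', -, rfl⟩ := (Submodule.mem_smul_pointwise_iff_exists _ _ _).1 hy
  exact map_verticalPrimeO_smul π hvan Φ y'

/-- The `π`-semilinear descent `Y/(T₂ - u)Y →ₛₗ[π] Xrs` (Mathlib `Submodule.liftQ`). [folklore] -/
def lift (Φ : Y →ₛₗ[π] Xrs) : QuotSMulTop (verticalPrimeO O u) Y →ₛₗ[π] Xrs :=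
  (verticalPrimeO O u • (⊤ : Submodule (PowerSeries (PowerSeries O)) Y)).liftQ Φ
    (smul_top_le_ker π hvan Φ)

@[simp] theorem lift_mk (Φ : Y →ₛₗ[π] Xrs) (y : Y) :
    lift π hvan Φ (Submodule.Quotient.mk y) = Φ y :=
  Submodule.liftQ_apply _ _ _

include hsec in
/-- **The control map.** The descent of `Φ` is `O⟦T₁⟧`-LINEAR for door 5's `fibreSection`
structure on the fibre: `Φ (section b • y) = π (section b) • Φ y = b • Φ y`. This is the `ctrl`
binder of `SplitsliceG4.fibreBoundAtPar_of_line`. [folklore] -/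
def ctrl (Φ : Y →ₛₗ[π] Xrs) :
    letI : Module (PowerSeries O) (QuotSMulTop (verticalPrimeO O u) Y) := fibreModule O u Y
    QuotSMulTop (verticalPrimeO O u) Y →ₗ[PowerSeries O] Xrs :=
  letI : Module (PowerSeries O) (QuotSMulTop (verticalPrimeO O u) Y) := fibreModule O u Y
  { toFun := lift π hvan Φ
    map_add' := fun a b => map_add _ a b
    map_smul' := fun b q => by
      change lift π hvan Φ (fibreSection O b • q) = b • lift π hvan Φ q
      rw [LinearMap.map_smulₛₗ, hsec] }

theorem ctrl_apply (Φ : Y →ₛₗ[π] Xrs) (q : QuotSMulTop (verticalPrimeO O u) Y) :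
    ctrl π hsec hvan Φ q = lift π hvan Φ q :=
  rfl

@[simp] theorem ctrl_mk (Φ : Y →ₛₗ[π] Xrs) (y : Y) :
    ctrl π hsec hvan Φ (Submodule.Quotient.mk y) = Φ y :=
  lift_mk π hvan Φ y

/-- `range ctrl = range Φ` (as sets). [folklore] -/
theorem range_ctrl (Φ : Y →ₛₗ[π] Xrs) : Set.range (ctrl π hsec hvan Φ) = Set.range Φ := by
  ext x
  constructor
  · rintro ⟨q, rfl⟩
    obtain ⟨y, rfl⟩ := Submodule.Quotient.mk_surjective _ q
    exact ⟨y, (ctrl_mk π hsec hvan Φ y).symm⟩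
  · rintro ⟨y, rfl⟩
    exact ⟨Submodule.Quotient.mk y, ctrl_mk π hsec hvan Φ y⟩

/-- `ctrl` is surjective iff `Φ` is. [folklore] -/
theorem ctrl_surjective_iff (Φ : Y →ₛₗ[π] Xrs) :
    Function.Surjective (ctrl π hsec hvan Φ) ↔ Function.Surjective Φ := by
  rw [← Set.range_eq_univ, range_ctrl, Set.range_eq_univ]

/-- `ctrl` is injective iff `ker Φ ≤ (T₂ - u) • Y` (the reverse inclusion is automatic).
[folklore] -/
theorem ctrl_injective_iff (Φ : Y →ₛₗ[π] Xrs) :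
    Function.Injective (ctrl π hsec hvan Φ) ↔
      ∀ y, Φ y = 0 → y ∈ verticalPrimeO O u • (⊤ : Submodule (PowerSeries (PowerSeries O)) Y) := by
  constructor
  · intro hinj y hy
    have h0 : ctrl π hsec hvan Φ (Submodule.Quotient.mk y) = ctrl π hsec hvan Φ 0 := by
      rw [ctrl_mk, hy, map_zero]
    exact (Submodule.Quotient.mk_eq_zero _).1 (hinj h0)
  · intro hker q₁ q₂ h
    obtain ⟨y₁, rfl⟩ := Submodule.Quotient.mk_surjective _ q₁
    obtain ⟨y₂, rfl⟩ := Submodule.Quotient.mk_surjective _ q₂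
    rw [ctrl_mk, ctrl_mk] at h
    refine (Submodule.Quotient.eq _).2 (hker _ ?_)
    rw [map_sub, h, sub_self]

/-- The kernel condition in the `Ideal.span {T₂ - u} • ⊤` phrasing of
`SplitsliceG5red.ctrl₂_of_lcd` / `mem_C_X_smul_top_of_toXCyc_eq_zero` (there `u = 0`,
`T₂ - u = C X`). [folklore] -/
theorem mem_smul_top_iff_mem_span_smul_top (y : Y) :
    y ∈ verticalPrimeO O u • (⊤ : Submodule (PowerSeries (PowerSeries O)) Y) ↔
      y ∈ Ideal.span {verticalPrimeO O u} • (⊤ : Submodule (PowerSeries (PowerSeries O)) Y) := by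
  rw [Submodule.ideal_span_singleton_smul]

/-! ## §3 Exact control: a linear equivalence, hence G4's `hctrl` -/

/-- **Exact control ⟹ `ctrl` is an `O⟦T₁⟧`-linear equivalence `Y/(T₂ - u)Y ≃ Xrs`.** [folklore] -/
def ctrlEquiv (Φ : Y →ₛₗ[π] Xrs) (hsurj : Function.Surjective Φ)
    (hker : ∀ y, Φ y = 0 → y ∈ verticalPrimeO O u • (⊤ : Submodule (PowerSeries (PowerSeries O)) Y)) :
    letI : Module (PowerSeries O) (QuotSMulTop (verticalPrimeO O u) Y) := fibreModule O u Y
    QuotSMulTop (verticalPrimeO O u) Y ≃ₗ[PowerSeries O] Xrs :=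
  letI : Module (PowerSeries O) (QuotSMulTop (verticalPrimeO O u) Y) := fibreModule O u Y
  LinearEquiv.ofBijective (ctrl π hsec hvan Φ)
    ⟨(ctrl_injective_iff π hsec hvan Φ).2 hker, (ctrl_surjective_iff π hsec hvan Φ).2 hsurj⟩

@[simp] theorem ctrlEquiv_apply (Φ : Y →ₛₗ[π] Xrs) (hsurj : Function.Surjective Φ)
    (hker : ∀ y, Φ y = 0 → y ∈ verticalPrimeO O u • (⊤ : Submodule (PowerSeries (PowerSeries O)) Y))
    (q : QuotSMulTop (verticalPrimeO O u) Y) :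
    ctrlEquiv π hsec hvan Φ hsurj hker q = ctrl π hsec hvan Φ q :=
  rfl

/-- **Exact control ⟹ G4's `hctrl`**: `ctrl` is a pseudo-isomorphism (indeed an isomorphism).
This is, verbatim, the pair `(ctrl, hctrl)` of `SplitsliceG4.fibreBoundAtPar_of_line`.
[cite: Washington1997, §13.2] -/
theorem isPseudoIsomorphism_ctrl (Φ : Y →ₛₗ[π] Xrs) (hsurj : Function.Surjective Φ)
    (hker : ∀ y, Φ y = 0 → y ∈ verticalPrimeO O u • (⊤ : Submodule (PowerSeries (PowerSeries O)) Y)) :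
    letI : Module (PowerSeries O) (QuotSMulTop (verticalPrimeO O u) Y) := fibreModule O u Y
    LinearMap.IsPseudoIsomorphism (ctrl π hsec hvan Φ) :=
  letI : Module (PowerSeries O) (QuotSMulTop (verticalPrimeO O u) Y) := fibreModule O u Y
  LinearMap.isPseudoIsomorphism_of_bijective (ctrlEquiv π hsec hvan Φ hsurj hker).bijective

include hsec hvan in
/-- **Exact control ⟹ `ch_{O⟦T₁⟧}(Y/(T₂ - u)Y) = ch_{O⟦T₁⟧}(X^{rel,str}_ℓ)`** (the fibre
characteristic ideal that door 5 reads equals the line's relaxed–strict characteristic ideal).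
[cite: Washington1997, §13.2] -/
theorem fibreCharIdeal_eq_of_exact (Φ : Y →ₛₗ[π] Xrs) (hsurj : Function.Surjective Φ)
    (hker : ∀ y, Φ y = 0 → y ∈ verticalPrimeO O u • (⊤ : Submodule (PowerSeries (PowerSeries O)) Y)) :
    fibreCharIdeal O u Y = Module.charIdeal (PowerSeries O) Xrs := by
  letI : Module (PowerSeries O) (QuotSMulTop (verticalPrimeO O u) Y) := fibreModule O u Y
  exact Module.charIdeal_eq_of_linearEquiv (ctrlEquiv π hsec hvan Φ hsurj hker)

/-- The same three conclusions from the `Ideal.span {T₂ - u} • ⊤` phrasing of the kernel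
condition (`SplitsliceG5red` §10 shape: `Surjective Φ ∧ ∀ y, Φ y = 0 → y ∈ span{T₂ - u} • ⊤`).
[cite: Washington1997, §13.2] -/
theorem isPseudoIsomorphism_ctrl_of_span (Φ : Y →ₛₗ[π] Xrs)
    (h : Function.Surjective Φ ∧ ∀ y, Φ y = 0 →
      y ∈ Ideal.span {verticalPrimeO O u} • (⊤ : Submodule (PowerSeries (PowerSeries O)) Y)) :
    letI : Module (PowerSeries O) (QuotSMulTop (verticalPrimeO O u) Y) := fibreModule O u Y
    LinearMap.IsPseudoIsomorphism (ctrl π hsec hvan Φ) :=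
  isPseudoIsomorphism_ctrl π hsec hvan Φ h.1 fun y hy =>
    (mem_smul_top_iff_mem_span_smul_top y).2 (h.2 y hy)

/-- The kernel of `ctrl` is, as a set, the image of `ker Φ` in `Y/(T₂ - u)Y`. [folklore] -/
theorem mem_ker_ctrl_iff (Φ : Y →ₛₗ[π] Xrs) (q : QuotSMulTop (verticalPrimeO O u) Y) :
    (letI : Module (PowerSeries O) (QuotSMulTop (verticalPrimeO O u) Y) := fibreModule O u Y;
      q ∈ LinearMap.ker (ctrl π hsec hvan Φ)) ↔
      q ∈ (LinearMap.ker Φ).map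
        (verticalPrimeO O u • (⊤ : Submodule (PowerSeries (PowerSeries O)) Y)).mkQ := by
  letI : Module (PowerSeries O) (QuotSMulTop (verticalPrimeO O u) Y) := fibreModule O u Y
  rw [LinearMap.mem_ker, ctrl_apply, ← LinearMap.mem_ker, lift, Submodule.ker_liftQ]

/-- The range of `ctrl` is the `O⟦T₁⟧`-span of `range Φ` (which is `range Φ` itself, `π` being
surjective). [folklore] -/
theorem range_ctrl_eq_span (Φ : Y →ₛₗ[π] Xrs) :
    (letI : Module (PowerSeries O) (QuotSMulTop (verticalPrimeO O u) Y) := fibreModule O u Y;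
      LinearMap.range (ctrl π hsec hvan Φ)) = Submodule.span (PowerSeries O) (Set.range Φ) := by
  letI : Module (PowerSeries O) (QuotSMulTop (verticalPrimeO O u) Y) := fibreModule O u Y
  apply le_antisymm
  · rintro x ⟨q, rfl⟩
    exact Submodule.subset_span (by rw [← range_ctrl π hsec hvan Φ]; exact ⟨q, rfl⟩)
  · rw [Submodule.span_le, ← range_ctrl π hsec hvan Φ]
    rintro x ⟨q, rfl⟩
    exact ⟨q, rfl⟩

end Descent

/-! ## §4 Finite-defect control over a DVR `O`: finite kernel and cokernel suffice -/

section FiniteDefect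

open IsLocalRing

variable {O : Type*} [CommRing O] [IsDomain O] [IsDiscreteValuationRing O]

/-- `𝔪_{O⟦T⟧}` has height `≥ 2` (`dim O⟦T⟧ ≥ dim O + 1 = 2`, Mathlib
`ringKrullDim_succ_le_ringKrullDim_powerseries`, `IsPrincipalIdealRing.ringKrullDim_eq_one`), so a
prime of height `≤ 1` is not the maximal ideal. [cite: StacksProject, Tag 00KD] -/
theorem ne_maximalIdeal_of_height_le_one (𝔮 : Ideal (PowerSeries O)) [𝔮.IsPrime]
    (h : 𝔮.height ≤ 1) : 𝔮 ≠ maximalIdeal (PowerSeries O) := by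
  intro heq
  have h2 : (2 : WithBot ℕ∞) ≤ ringKrullDim (PowerSeries O) := by
    have := ringKrullDim_succ_le_ringKrullDim_powerseries (R := O)
    rwa [IsPrincipalIdealRing.ringKrullDim_eq_one O (IsDiscreteValuationRing.not_isField O),
      show (1 : WithBot ℕ∞) + 1 = 2 from one_add_one_eq_two] at this
  rw [← maximalIdeal_height_eq_ringKrullDim, ← heq] at h2
  have h' : ((𝔮.height : WithBot ℕ∞)) ≤ (1 : ℕ∞) := WithBot.coe_le_coe.2 h
  have : (2 : WithBot ℕ∞) ≤ ((1 : ℕ∞) : WithBot ℕ∞) := h2.trans h'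
  exact absurd (WithBot.coe_le_coe.1 this) (by decide)

variable {N : Type*} [AddCommGroup N] [Module (PowerSeries O) N]

/-- **A finite `O⟦T⟧`-module is pseudo-null** (NSW (5.1.4) Remark 4; the tree's argument for
`Λ = ℤ_p⟦T⟧`, `IwasawaAlgebra.isPseudoNull_of_finite`, verbatim): at a prime `𝔭` of height `≤ 1`
pick `s ∈ 𝔪 ∖ 𝔭`; pigeonhole on `sⁿ m` and the unit `1 - s^k`.
DEDUP NOTE: same statement as `…Theorems.BiquadraticEisensteinDescentEisensteinHeartFlatCMInertBadKPrimeCharIdealBaseChange.isPseudoNull_of_finite`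
(universe-`0` `𝒪` there; reproved here to keep this companion's imports inside `Literature`).
[cite: NeukirchSchmidtWingberg2008, Ch. V §1, (5.1.4) Remark 4] -/
theorem isPseudoNull_of_finite [Finite N] : Module.IsPseudoNull (PowerSeries O) N := by
  intro 𝔭 h𝔭
  have hne := ne_maximalIdeal_of_height_le_one 𝔭.asIdeal h𝔭
  have hnot : ¬ maximalIdeal (PowerSeries O) ≤ 𝔭.asIdeal := fun h =>
    hne ((IsLocalRing.maximalIdeal.isMaximal _).eq_of_le 𝔭.isPrime.ne_top h).symm
  obtain ⟨s, hs𝔪, hs𝔭⟩ := Set.not_subset.1 hnot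
  rw [LocalizedModule.subsingleton_iff]
  intro m
  obtain ⟨i, j, hij, heq⟩ := Finite.exists_ne_map_eq_of_infinite (fun n : ℕ => s ^ n • m)
  wlog hlt : i < j generalizing i j
  · exact this j i hij.symm heq.symm (lt_of_le_of_ne (not_lt.1 hlt) hij.symm)
  refine ⟨s ^ i, fun h => hs𝔭 (𝔭.isPrime.mem_of_pow_mem _ h), ?_⟩
  obtain ⟨k, rfl⟩ := Nat.exists_eq_add_of_lt hlt
  have hu : IsUnit (1 - s ^ (k + 1)) :=
    isUnit_one_sub_self_of_mem_nonunits _ (Ideal.pow_mem_of_mem _ hs𝔪 _ k.succ_pos)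
  have h0 : (1 - s ^ (k + 1)) • (s ^ i • m) = 0 := by
    rw [sub_smul, one_smul, ← mul_smul, ← pow_add, sub_eq_zero]
    rw [heq]
    congr 1
    ring
  exact (hu.smul_eq_zero).1 h0

variable {N' : Type*} [AddCommGroup N'] [Module (PowerSeries O) N']

/-- An `O⟦T⟧`-linear map with finite kernel and finite cokernel is a pseudo-isomorphism.
[cite: NeukirchSchmidtWingberg2008, Ch. V §1, (5.1.4) Remark 4] -/
theorem isPseudoIsomorphism_of_finite_ker_coker (f : N →ₗ[PowerSeries O] N')
    (hk : Finite (LinearMap.ker f)) (hc : Finite (N' ⧸ LinearMap.range f)) :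
    LinearMap.IsPseudoIsomorphism f :=
  ⟨isPseudoNull_of_finite, isPseudoNull_of_finite⟩

variable {u : O} (π : PowerSeries (PowerSeries O) →+* PowerSeries O)
  (hsec : ∀ b, π (fibreSection O b) = b) (hvan : π (verticalPrimeO O u) = 0)
  {Y Xrs : Type*} [AddCommGroup Y] [Module (PowerSeries (PowerSeries O)) Y]
  [AddCommGroup Xrs] [Module (PowerSeries O) Xrs]

/-- **Finite-defect control ⟹ G4's `hctrl`.** If `ker Φ/(T₂ - u)Y` (the image of `ker Φ` in the
fibre) and `Xrs/⟨range Φ⟩` are finite, `ctrl` is a pseudo-isomorphism of `O⟦T₁⟧`-modules.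
(Greenberg-type control theorems deliver exactly finite kernel and cokernel.)
[cite: NeukirchSchmidtWingberg2008, Ch. V §1, (5.1.4) Remark 4] [cite: Washington1997, §13.2] -/
theorem isPseudoIsomorphism_ctrl_of_finite (Φ : Y →ₛₗ[π] Xrs)
    (hk : Finite ((LinearMap.ker Φ).map
      (verticalPrimeO O u • (⊤ : Submodule (PowerSeries (PowerSeries O)) Y)).mkQ))
    (hc : Finite (Xrs ⧸ Submodule.span (PowerSeries O) (Set.range Φ))) :
    letI : Module (PowerSeries O) (QuotSMulTop (verticalPrimeO O u) Y) := fibreModule O u Y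
    LinearMap.IsPseudoIsomorphism (ctrl π hsec hvan Φ) := by
  letI : Module (PowerSeries O) (QuotSMulTop (verticalPrimeO O u) Y) := fibreModule O u Y
  refine isPseudoIsomorphism_of_finite_ker_coker _ ?_ ?_
  · refine Finite.of_injective (fun q : LinearMap.ker (ctrl π hsec hvan Φ) =>
      (⟨q.1, (mem_ker_ctrl_iff π hsec hvan Φ q.1).1 q.2⟩ :
        (LinearMap.ker Φ).map (verticalPrimeO O u • (⊤ : Submodule (PowerSeries (PowerSeries O)) Y)).mkQ)) ?_
    intro a b h
    simp only [Subtype.mk.injEq] at h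
    exact Subtype.ext h
  · rw [range_ctrl_eq_span π hsec hvan Φ]
    exact hc

include hsec hvan in
/-- **Finite-defect control ⟹ `ch(Y/(T₂ - u)Y) = ch(X^{rel,str}_ℓ)`.**
[cite: Washington1997, §13.2] -/
theorem fibreCharIdeal_eq_of_finite (Φ : Y →ₛₗ[π] Xrs)
    (hk : Finite ((LinearMap.ker Φ).map
      (verticalPrimeO O u • (⊤ : Submodule (PowerSeries (PowerSeries O)) Y)).mkQ))
    (hc : Finite (Xrs ⧸ Submodule.span (PowerSeries O) (Set.range Φ))) :
    fibreCharIdeal O u Y = Module.charIdeal (PowerSeries O) Xrs := by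
  letI : Module (PowerSeries O) (QuotSMulTop (verticalPrimeO O u) Y) := fibreModule O u Y
  exact Module.charIdeal_eq_of_arePseudoIsomorphic
    ⟨ctrl π hsec hvan Φ, isPseudoIsomorphism_ctrl_of_finite π hsec hvan Φ hk hc⟩

end FiniteDefect

/-! ## §5 Non-vacuity of the abstract evaluation: the point `u = 0` -/

section PointZero

variable (O : Type*) [CommRing O]

/-- Evaluation at `T₂ = 0`: `O⟦T₂⟧⟦T₁⟧ → O⟦T₁⟧`, coefficientwise constant term
(`SplitsliceG5red.specT₂` for `O = ℤ_p`). [folklore] -/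
def π₀ : PowerSeries (PowerSeries O) →+* PowerSeries O :=
  PowerSeries.map (PowerSeries.constantCoeff (R := O))

/-- `π₀ ∘ fibreSection = id` (the hypothesis `hsec`). [folklore] -/
theorem π₀_fibreSection (b : PowerSeries O) : π₀ O (fibreSection O b) = b := by
  rw [π₀, fibreSection, ← RingHom.comp_apply, ← PowerSeries.map_comp,
    show (PowerSeries.constantCoeff (R := O)).comp (PowerSeries.C (R := O)) = RingHom.id O from
      RingHom.ext fun a => PowerSeries.constantCoeff_C a,
    PowerSeries.map_id]
  rfl

/-- `π₀ (T₂ - 0) = 0` (the hypothesis `hvan` at `u = 0`). [folklore] -/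
theorem π₀_verticalPrimeO_zero : π₀ O (verticalPrimeO O 0) = 0 := by
  rw [π₀, verticalPrimeO, PowerSeries.map_C, map_sub, PowerSeries.constantCoeff_X,
    PowerSeries.constantCoeff_C, sub_zero, map_zero]

end PointZero

/-! ## §6 The fibre IS the base change of `X` along `θ_u` (universal property); the producer's
`θ`-semilinear entrance; the orbit form `X/(ker θ)X` when `θ_u` is surjective

Door 5 (`QtameDoor5.FibreBoundOver`) reads the fibre `Y/(T₂ - u)Y` of `Y = O⟦T₂⟧⟦T₁⟧ ⊗_A X`
(`A = Λ₂`, algebra `map (map (algebraMap ℤ_[p] O))`) for EVERY admissible coefficient ring `O = S` and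
root `u`. Let `θ = θ_u : A → O⟦T₁⟧` be the composite `π ∘ algebraMap` (`hθ`; for door 5 `F ↦ F(T₁, u)`
with coefficients in `S`). NO `A`-algebra structure is put on `O⟦T₁⟧` (it would clash with
`PowerSeries.instAlgebra` — two `A`-structures on `O⟦T₂⟧⟦T₁⟧`); instead the base change
`O⟦T₁⟧ ⊗_{A,θ} X` is CHARACTERISED: the fibre with door 5's `fibreSection` structure and the
`θ`-semilinear `toFibre : x ↦ [1 ⊗ x]` has the universal property of extension of scalars along `θ`
(`existsUnique_factor`; Bourbaki, Algebra II §5.1). Consequently the producer of CTRL_ℓ only has to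
supply a `θ`-SEMILINEAR map on `X` itself, `φ : X →ₛₗ[θ] X^{rel,str}_ℓ` (restriction-dual along the
line), and `ctrl π hsec hvan (baseLift φ)` IS the base-change control map
`O⟦T₁⟧ ⊗_{A,θ} X → X^{rel,str}_ℓ` of Greenberg / Skinner–Urban; its pseudo-isomorphy (G4's `hctrl`)
follows from finiteness of its kernel and of `X^{rel,str}_ℓ/⟨φ(X)⟩`
(`isPseudoIsomorphism_ctrl_baseLift_of_finite_ker`, any `S`), and — when `θ` is SURJECTIVE
(`S = ℤ_p[u]`; `ker θ = P_u = (Φ_{p^n}(1 + T₂))` of height one: the ORBIT FORM, fibre `= X/P_u X`,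
`toFibre_surjective` + `toFibre_eq_zero_of_mem`) — from statements on `X` alone:
`isPseudoIsomorphism_ctrl_baseLift_of_exact` (`φ` onto, `ker φ ≤ (ker θ)X`) and
`isPseudoIsomorphism_ctrl_baseLift_of_finite` (finite defects `ker φ/(ker θ)X`, `X^{rel,str}_ℓ/⟨φ(X)⟩`).
For a general `S ⊋ ℤ_p[u]` (door 5 allows the valuation ring of a splitting field) `θ_u` is not onto
and the fibre is the flat base change `S⟦T₁⟧ ⊗_{ℤ_p[u]⟦T₁⟧} (X/P_u X)`; only 6a–6c apply there. -/

section BaseChange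

open TensorProduct

variable {O : Type*} [CommRing O] {u : O} (π : PowerSeries (PowerSeries O) →+* PowerSeries O)
  (hsec : ∀ b, π (fibreSection O b) = b) (hvan : π (verticalPrimeO O u) = 0)
  (hker : ∀ F, π F = 0 → F ∈ Ideal.span {verticalPrimeO O u})
  {A : Type*} [CommRing A] [Algebra A (PowerSeries (PowerSeries O))] (θ : A →+* PowerSeries O)
  (hθ : ∀ a, π (algebraMap A (PowerSeries (PowerSeries O)) a) = θ a)
  {X Xrs : Type*} [AddCommGroup X] [Module A X] [AddCommGroup Xrs] [Module (PowerSeries O) Xrs]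

include hker in
/-- If `π D = 0` then `(D·F) ⊗ x ∈ (T₂ - u)•Y` (`ker π = (T₂ - u)`, hypothesis `hker`). [folklore] -/
theorem tmul_mem_smul_top_of_map_eq_zero (D F : PowerSeries (PowerSeries O)) (hD : π D = 0) (x : X) :
    (D * F) ⊗ₜ[A] x ∈ verticalPrimeO O u •
      (⊤ : Submodule (PowerSeries (PowerSeries O)) ((PowerSeries (PowerSeries O)) ⊗[A] X)) := by
  obtain ⟨G, hG⟩ := Ideal.mem_span_singleton'.1 (hker D hD)
  have h : (D * F) ⊗ₜ[A] x = verticalPrimeO O u • ((G * F) ⊗ₜ[A] x) := by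
    rw [TensorProduct.smul_tmul', smul_eq_mul, ← mul_assoc, mul_comm (verticalPrimeO O u) G, hG]
  rw [h]
  exact Submodule.smul_mem_pointwise_smul _ _ _ Submodule.mem_top

include hker in
/-- `[F₁ ⊗ x] = [F₂ ⊗ x]` in the fibre as soon as `π F₁ = π F₂`. [folklore] -/
theorem mk_tmul_eq_of_map_eq (F₁ F₂ : PowerSeries (PowerSeries O)) (h : π F₁ = π F₂) (x : X) :
    (Submodule.Quotient.mk (F₁ ⊗ₜ[A] x) :
        QuotSMulTop (verticalPrimeO O u) ((PowerSeries (PowerSeries O)) ⊗[A] X)) =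
      Submodule.Quotient.mk (F₂ ⊗ₜ[A] x) := by
  rw [Submodule.Quotient.eq, ← TensorProduct.sub_tmul, ← mul_one (F₁ - F₂)]
  exact tmul_mem_smul_top_of_map_eq_zero π hker _ _ (by rw [map_sub, h, sub_self]) x

/-! ### 6a. The producer's entrance: a `θ`-semilinear `φ` on `X` itself -/

/-- `(F, x) ↦ π F • φ x`, biadditive. [folklore] -/
def liftAux (φ : X →ₛₗ[θ] Xrs) : PowerSeries (PowerSeries O) →+ X →+ Xrs where
  toFun F :=
    { toFun := fun x => π F • φ x
      map_zero' := by rw [map_zero, smul_zero]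
      map_add' := fun x₁ x₂ => by rw [map_add, smul_add] }
  map_zero' := by
    ext x
    simp only [map_zero, zero_smul, AddMonoidHom.coe_mk, ZeroHom.coe_mk, AddMonoidHom.zero_apply]
  map_add' F G := by
    ext x
    simp only [map_add, add_smul, AddMonoidHom.coe_mk, ZeroHom.coe_mk, AddMonoidHom.add_apply]

omit [Algebra A (PowerSeries (PowerSeries O))] in
theorem liftAux_apply (φ : X →ₛₗ[θ] Xrs) (F : PowerSeries (PowerSeries O)) (x : X) :
    liftAux π θ φ F x = π F • φ x := rfl

/-- **The base-change lift** of a `θ`-semilinear `φ : X → Xrs`: the `π`-semilinear map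
`Y = O⟦T₂⟧⟦T₁⟧ ⊗_A X → Xrs`, `F ⊗ x ↦ π F • φ x` (well defined by `hθ`; an admissible `Φ` of §2).
[folklore] -/
def baseLift (φ : X →ₛₗ[θ] Xrs) : (PowerSeries (PowerSeries O)) ⊗[A] X →ₛₗ[π] Xrs where
  toFun := TensorProduct.liftAddHom (liftAux π θ φ) (fun a F x => by
    rw [liftAux_apply, liftAux_apply, LinearMap.map_smulₛₗ, Algebra.smul_def, map_mul, hθ, mul_smul]
    exact smul_comm _ _ _)
  map_add' := map_add _
  map_smul' G y := by
    induction y using TensorProduct.induction_on with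
    | zero => simp only [smul_zero, map_zero]
    | tmul F x =>
        simp only [TensorProduct.smul_tmul', smul_eq_mul, TensorProduct.liftAddHom_tmul, liftAux_apply,
          map_mul, mul_smul]
    | add y₁ y₂ h₁ h₂ => simp only [smul_add, map_add, h₁, h₂]

theorem baseLift_tmul (φ : X →ₛₗ[θ] Xrs) (F : PowerSeries (PowerSeries O)) (x : X) :
    baseLift π θ hθ φ (F ⊗ₜ[A] x) = π F • φ x := rfl

theorem baseLift_one_tmul (φ : X →ₛₗ[θ] Xrs) (x : X) : baseLift π θ hθ φ (1 ⊗ₜ[A] x) = φ x := by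
  rw [baseLift_tmul, map_one, one_smul]

theorem range_subset_range_baseLift (φ : X →ₛₗ[θ] Xrs) :
    Set.range φ ⊆ Set.range (baseLift π θ hθ φ) := by
  rintro _ ⟨x, rfl⟩
  exact ⟨1 ⊗ₜ[A] x, baseLift_one_tmul π θ hθ φ x⟩

/-- `φ` onto ⟹ `baseLift φ` onto. [folklore] -/
theorem baseLift_surjective (φ : X →ₛₗ[θ] Xrs) (h : Function.Surjective φ) :
    Function.Surjective (baseLift π θ hθ φ) := fun z => by
  obtain ⟨x, rfl⟩ := h z
  exact ⟨1 ⊗ₜ[A] x, baseLift_one_tmul π θ hθ φ x⟩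

/-- `⟨range (baseLift φ)⟩ = ⟨range φ⟩` as `O⟦T₁⟧`-submodules of `Xrs`. [folklore] -/
theorem span_range_baseLift (φ : X →ₛₗ[θ] Xrs) :
    Submodule.span (PowerSeries O) (Set.range (baseLift π θ hθ φ)) =
      Submodule.span (PowerSeries O) (Set.range φ) := by
  apply le_antisymm
  · rw [Submodule.span_le]
    rintro _ ⟨y, rfl⟩
    induction y using TensorProduct.induction_on with
    | zero => rw [map_zero]; exact zero_mem _
    | tmul F x =>
        rw [baseLift_tmul]
        exact Submodule.smul_mem _ _ (Submodule.subset_span ⟨x, rfl⟩)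
    | add y₁ y₂ h₁ h₂ => rw [map_add]; exact add_mem h₁ h₂
  · exact Submodule.span_mono (range_subset_range_baseLift π θ hθ φ)

/-- The range of `ctrl (baseLift φ)` is `⟨φ(X)⟩`. [folklore] -/
theorem range_ctrl_baseLift (φ : X →ₛₗ[θ] Xrs) :
    (letI := fibreModule O u ((PowerSeries (PowerSeries O)) ⊗[A] X);
      LinearMap.range (ctrl π hsec hvan (baseLift π θ hθ φ))) =
      Submodule.span (PowerSeries O) (Set.range φ) := by
  rw [range_ctrl_eq_span, span_range_baseLift]

/-! ### 6b. The structure map `toFibre : X → Y/(T₂ - u)Y` and the universal property -/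

/-- **The structure map of the base change**: `x ↦ [1 ⊗ x]`, `θ`-SEMILINEAR for door 5's
`fibreSection` structure (`[1 ⊗ a·x] = [algebraMap a ⊗ x] = [fibreSection (θ a) ⊗ x]` by `hker`).
[folklore] -/
def toFibre :
    letI := fibreModule O u ((PowerSeries (PowerSeries O)) ⊗[A] X)
    X →ₛₗ[θ] QuotSMulTop (verticalPrimeO O u) ((PowerSeries (PowerSeries O)) ⊗[A] X) :=
  letI := fibreModule O u ((PowerSeries (PowerSeries O)) ⊗[A] X)
  { toFun := fun x => Submodule.Quotient.mk (1 ⊗ₜ[A] x)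
    map_add' := fun x₁ x₂ => by
      simp only [TensorProduct.tmul_add, Submodule.Quotient.mk_add]
    map_smul' := fun a x => by
      change _ = fibreSection O (θ a) •
        (Submodule.Quotient.mk (1 ⊗ₜ[A] x) :
          QuotSMulTop (verticalPrimeO O u) ((PowerSeries (PowerSeries O)) ⊗[A] X))
      rw [← Submodule.Quotient.mk_smul, TensorProduct.smul_tmul', smul_eq_mul, mul_one,
        ← TensorProduct.smul_tmul, Algebra.smul_def, mul_one]
      exact mk_tmul_eq_of_map_eq π hker _ _ (by rw [hθ, hsec]) x }

theorem toFibre_apply (x : X) :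
    toFibre π hsec hker θ hθ x =
      (Submodule.Quotient.mk (1 ⊗ₜ[A] x) :
        QuotSMulTop (verticalPrimeO O u) ((PowerSeries (PowerSeries O)) ⊗[A] X)) := rfl

/-- `ctrl (baseLift φ) ∘ toFibre = φ`: the factorisation through the base change. [folklore] -/
theorem ctrl_baseLift_toFibre (φ : X →ₛₗ[θ] Xrs) (x : X) :
    ctrl π hsec hvan (baseLift π θ hθ φ) (toFibre π hsec hker θ hθ x) = φ x := by
  rw [toFibre_apply, ctrl_mk, baseLift_one_tmul]

include hker in
/-- `[F ⊗ x] = π F • toFibre x` (for the `fibreSection` structure). [folklore] -/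
theorem mk_tmul_eq_smul_toFibre (F : PowerSeries (PowerSeries O)) (x : X) :
    letI := fibreModule O u ((PowerSeries (PowerSeries O)) ⊗[A] X)
    (Submodule.Quotient.mk (F ⊗ₜ[A] x) :
        QuotSMulTop (verticalPrimeO O u) ((PowerSeries (PowerSeries O)) ⊗[A] X)) =
      π F • toFibre π hsec hker θ hθ x := by
  letI := fibreModule O u ((PowerSeries (PowerSeries O)) ⊗[A] X)
  change _ = fibreSection O (π F) •
    (Submodule.Quotient.mk (1 ⊗ₜ[A] x) :
      QuotSMulTop (verticalPrimeO O u) ((PowerSeries (PowerSeries O)) ⊗[A] X))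
  rw [← Submodule.Quotient.mk_smul, TensorProduct.smul_tmul', smul_eq_mul, mul_one]
  exact mk_tmul_eq_of_map_eq π hker _ _ (by rw [hsec]) x

include hker in
/-- The fibre is generated, as an `O⟦T₁⟧`-module, by `toFibre(X)`. [folklore] -/
theorem span_range_toFibre :
    (letI := fibreModule O u ((PowerSeries (PowerSeries O)) ⊗[A] X);
      Submodule.span (PowerSeries O) (Set.range (toFibre π hsec hker θ hθ (X := X)))) = ⊤ := by
  letI := fibreModule O u ((PowerSeries (PowerSeries O)) ⊗[A] X)
  rw [eq_top_iff]
  rintro q -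
  obtain ⟨y, rfl⟩ := Submodule.Quotient.mk_surjective _ q
  induction y using TensorProduct.induction_on with
  | zero => rw [Submodule.Quotient.mk_zero]; exact zero_mem _
  | tmul F x =>
      rw [mk_tmul_eq_smul_toFibre π hsec hker θ hθ F x]
      exact Submodule.smul_mem _ _ (Submodule.subset_span ⟨x, rfl⟩)
  | add y₁ y₂ h₁ h₂ => rw [Submodule.Quotient.mk_add]; exact add_mem h₁ h₂

include hker in
/-- Two `O⟦T₁⟧`-linear maps out of the fibre that agree on `toFibre(X)` are equal. [folklore] -/
theorem ext_on_toFibre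
    (g₁ g₂ :
      letI := fibreModule O u ((PowerSeries (PowerSeries O)) ⊗[A] X)
      QuotSMulTop (verticalPrimeO O u) ((PowerSeries (PowerSeries O)) ⊗[A] X) →ₗ[PowerSeries O] Xrs)
    (h : ∀ x, g₁ (toFibre π hsec hker θ hθ x) = g₂ (toFibre π hsec hker θ hθ x)) : g₁ = g₂ := by
  letI := fibreModule O u ((PowerSeries (PowerSeries O)) ⊗[A] X)
  exact LinearMap.ext_on_range (span_range_toFibre π hsec hker θ hθ) h

include hvan hker in
/-- **UNIVERSAL PROPERTY: the fibre `Y/(T₂ - u)Y` with `toFibre` IS the base change `O⟦T₁⟧ ⊗_{A,θ} X`.**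
Every `θ`-semilinear `φ : X → N` into an `O⟦T₁⟧`-module factors uniquely through `toFibre` by an
`O⟦T₁⟧`-linear map, namely `ctrl π hsec hvan (baseLift φ)` (Bourbaki, Algebra II §5.1, extension of
scalars). For door 5: the fibre of `Λ_{2,S} ⊗_{Λ₂} X_Gr₂` at `u` is `S⟦T₁⟧ ⊗_{Λ₂,θ_u} X_Gr₂`. [folklore] -/
theorem existsUnique_factor (φ : X →ₛₗ[θ] Xrs) :
    ∃! g :
      (letI := fibreModule O u ((PowerSeries (PowerSeries O)) ⊗[A] X);
        QuotSMulTop (verticalPrimeO O u) ((PowerSeries (PowerSeries O)) ⊗[A] X) →ₗ[PowerSeries O] Xrs),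
      ∀ x, g (toFibre π hsec hker θ hθ x) = φ x :=
  ⟨ctrl π hsec hvan (baseLift π θ hθ φ), ctrl_baseLift_toFibre π hsec hvan hker θ hθ φ,
    fun g hg => ext_on_toFibre π hsec hker θ hθ _ _ fun x => by
      rw [hg, ctrl_baseLift_toFibre]⟩

/-! ### 6c. Any coefficient ring: `hctrl` from finiteness of the kernel of the control map -/

/-- **CTRL_ℓ, general `S`** (`O` a DVR): if the base-change control map `ctrl (baseLift φ)` has finite
kernel and `Xrs/⟨φ(X)⟩` is finite, it is a pseudo-isomorphism — G4's `(ctrl, hctrl)`.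
[cite: NeukirchSchmidtWingberg2008, Ch. V §1, (5.1.4) Remark 4] [cite: Washington1997, §13.2] -/
theorem isPseudoIsomorphism_ctrl_baseLift_of_finite_ker [IsDomain O] [IsDiscreteValuationRing O]
    (φ : X →ₛₗ[θ] Xrs)
    (hk :
      letI := fibreModule O u ((PowerSeries (PowerSeries O)) ⊗[A] X)
      Finite (LinearMap.ker (ctrl π hsec hvan (baseLift π θ hθ φ))))
    (hc : Finite (Xrs ⧸ Submodule.span (PowerSeries O) (Set.range φ))) :
    letI := fibreModule O u ((PowerSeries (PowerSeries O)) ⊗[A] X)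
    LinearMap.IsPseudoIsomorphism (ctrl π hsec hvan (baseLift π θ hθ φ)) := by
  letI := fibreModule O u ((PowerSeries (PowerSeries O)) ⊗[A] X)
  refine isPseudoIsomorphism_of_finite_ker_coker _ hk ?_
  rw [range_ctrl_baseLift π hsec hvan θ hθ φ]
  exact hc

/-! ### 6d. The orbit form: `θ` surjective (`S = ℤ_p[u]`, `ker θ = P_u`) — the fibre is `X/(ker θ)X` -/

/-- `toFibre` kills `(ker θ)·X`. [folklore] -/
theorem toFibre_eq_zero_of_mem {x : X} (hx : x ∈ RingHom.ker θ • (⊤ : Submodule A X)) :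
    toFibre π hsec hker θ hθ x = 0 := by
  letI := fibreModule O u ((PowerSeries (PowerSeries O)) ⊗[A] X)
  refine Submodule.smul_induction_on hx (fun a ha n _ => ?_) (fun x y hx hy => ?_)
  · rw [LinearMap.map_smulₛₗ, RingHom.mem_ker.1 ha, zero_smul]
  · rw [map_add, hx, hy, add_zero]

include hker in
/-- **`θ` surjective ⟹ every element of the fibre is `toFibre x`** (`[F ⊗ x] = [1 ⊗ a·x]` for any
`a` with `θ a = π F`): the fibre is a quotient of `X`. [folklore] -/
theorem toFibre_surjective (hs : Function.Surjective θ) :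
    Function.Surjective (toFibre π hsec hker θ hθ (u := u) (X := X)) := by
  letI := fibreModule O u ((PowerSeries (PowerSeries O)) ⊗[A] X)
  intro q
  obtain ⟨y, rfl⟩ := Submodule.Quotient.mk_surjective _ q
  induction y using TensorProduct.induction_on with
  | zero => exact ⟨0, by rw [map_zero, Submodule.Quotient.mk_zero]⟩
  | tmul F x =>
      obtain ⟨a, ha⟩ := hs (π F)
      refine ⟨a • x, ?_⟩
      rw [LinearMap.map_smulₛₗ, ha, ← mk_tmul_eq_smul_toFibre π hsec hker θ hθ F x]
  | add y₁ y₂ h₁ h₂ =>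
      obtain ⟨x₁, hx₁⟩ := h₁
      obtain ⟨x₂, hx₂⟩ := h₂
      exact ⟨x₁ + x₂, by rw [map_add, hx₁, hx₂, Submodule.Quotient.mk_add]⟩

include hsec hvan hker in
/-- `θ` surjective: `baseLift φ y = 0 ⟹ y ∈ (T₂ - u)•Y` as soon as `ker φ ≤ (ker θ)·X`. [folklore] -/
theorem mem_smul_top_of_baseLift_eq_zero (hs : Function.Surjective θ) (φ : X →ₛₗ[θ] Xrs)
    (hφk : ∀ x, φ x = 0 → x ∈ RingHom.ker θ • (⊤ : Submodule A X))
    (y : (PowerSeries (PowerSeries O)) ⊗[A] X) (hy : baseLift π θ hθ φ y = 0) :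
    y ∈ verticalPrimeO O u •
      (⊤ : Submodule (PowerSeries (PowerSeries O)) ((PowerSeries (PowerSeries O)) ⊗[A] X)) := by
  obtain ⟨x, hx⟩ :=
    toFibre_surjective π hsec hker θ hθ hs
      (Submodule.Quotient.mk y : QuotSMulTop (verticalPrimeO O u) ((PowerSeries (PowerSeries O)) ⊗[A] X))
  have hφx : φ x = 0 := by
    rw [← ctrl_baseLift_toFibre π hsec hvan hker θ hθ φ x, hx, ctrl_mk, hy]
  have h0 := toFibre_eq_zero_of_mem π hsec hker θ hθ (hφk x hφx)
  rw [hx] at h0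
  exact (Submodule.Quotient.mk_eq_zero _).1 h0

include hker in
/-- **CTRL_ℓ in the orbit form, exact version** (`θ` surjective, e.g. `S = ℤ_p[u]`, `ker θ = P_u`):
if the restriction-dual `φ : X_Gr₂ → X^{rel,str}_ℓ` along the line is onto with `ker φ ≤ P_u·X_Gr₂`
(Greenberg specialisation at the height-one prime `P_u`, exact form), then `ctrl (baseLift φ)` is G4's
`(ctrl, hctrl)`. [cite: Washington1997, §13.2] -/
theorem isPseudoIsomorphism_ctrl_baseLift_of_exact (hs : Function.Surjective θ) (φ : X →ₛₗ[θ] Xrs)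
    (hφs : Function.Surjective φ) (hφk : ∀ x, φ x = 0 → x ∈ RingHom.ker θ • (⊤ : Submodule A X)) :
    letI := fibreModule O u ((PowerSeries (PowerSeries O)) ⊗[A] X)
    LinearMap.IsPseudoIsomorphism (ctrl π hsec hvan (baseLift π θ hθ φ)) :=
  isPseudoIsomorphism_ctrl π hsec hvan _ (baseLift_surjective π θ hθ φ hφs)
    (mem_smul_top_of_baseLift_eq_zero π hsec hvan hker θ hθ hs φ hφk)

include π hsec hvan hker hθ in
/-- Exact orbit-form control ⟹ `ch_{O⟦T₁⟧}(Y/(T₂ - u)Y) = ch_{O⟦T₁⟧}(X^{rel,str}_ℓ)`.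
[cite: Washington1997, §13.2] -/
theorem fibreCharIdeal_eq_of_baseLift_exact (hs : Function.Surjective θ) (φ : X →ₛₗ[θ] Xrs)
    (hφs : Function.Surjective φ) (hφk : ∀ x, φ x = 0 → x ∈ RingHom.ker θ • (⊤ : Submodule A X)) :
    fibreCharIdeal O u ((PowerSeries (PowerSeries O)) ⊗[A] X) =
      Module.charIdeal (PowerSeries O) Xrs :=
  fibreCharIdeal_eq_of_exact π hsec hvan _ (baseLift_surjective π θ hθ φ hφs)
    (mem_smul_top_of_baseLift_eq_zero π hsec hvan hker θ hθ hs φ hφk)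

/-- `toFibre` factors through `X/(ker θ)X`. [folklore] -/
def toFibreQ :
    letI := fibreModule O u ((PowerSeries (PowerSeries O)) ⊗[A] X)
    X ⧸ (RingHom.ker θ • (⊤ : Submodule A X)) →ₛₗ[θ]
      QuotSMulTop (verticalPrimeO O u) ((PowerSeries (PowerSeries O)) ⊗[A] X) :=
  letI := fibreModule O u ((PowerSeries (PowerSeries O)) ⊗[A] X)
  (RingHom.ker θ • (⊤ : Submodule A X)).liftQ (toFibre π hsec hker θ hθ) fun _ hx =>
    LinearMap.mem_ker.2 (toFibre_eq_zero_of_mem π hsec hker θ hθ hx)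

theorem toFibreQ_mk (x : X) :
    toFibreQ π hsec hker θ hθ (Submodule.Quotient.mk x) = toFibre π hsec hker θ hθ x := rfl

include hker in
/-- **CTRL_ℓ in the orbit form, finite-defect version** (`O` a DVR, `θ` surjective): finite
`ker φ/(ker θ)X` and finite `Xrs/⟨φ(X)⟩` give G4's `hctrl` for `ctrl (baseLift φ)`.
[cite: NeukirchSchmidtWingberg2008, Ch. V §1, (5.1.4) Remark 4] [cite: Washington1997, §13.2] -/
theorem isPseudoIsomorphism_ctrl_baseLift_of_finite [IsDomain O] [IsDiscreteValuationRing O]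
    (hs : Function.Surjective θ) (φ : X →ₛₗ[θ] Xrs)
    (hk : Finite ((LinearMap.ker φ).map (RingHom.ker θ • (⊤ : Submodule A X)).mkQ))
    (hc : Finite (Xrs ⧸ Submodule.span (PowerSeries O) (Set.range φ))) :
    letI := fibreModule O u ((PowerSeries (PowerSeries O)) ⊗[A] X)
    LinearMap.IsPseudoIsomorphism (ctrl π hsec hvan (baseLift π θ hθ φ)) := by
  letI := fibreModule O u ((PowerSeries (PowerSeries O)) ⊗[A] X)
  refine isPseudoIsomorphism_ctrl_baseLift_of_finite_ker π hsec hvan θ hθ φ ?_ hc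
  -- the kernel of the control map is the image of `ker φ/(ker θ)X` under `toFibreQ`
  refine Finite.of_surjective
    (fun q : (LinearMap.ker φ).map (RingHom.ker θ • (⊤ : Submodule A X)).mkQ =>
      (⟨toFibreQ π hsec hker θ hθ q.1, ?_⟩ :
        LinearMap.ker (ctrl π hsec hvan (baseLift π θ hθ φ)))) ?_
  · obtain ⟨x, hx, hq⟩ := Submodule.mem_map.1 q.2
    rw [LinearMap.mem_ker, ← hq, Submodule.mkQ_apply, toFibreQ_mk, ctrl_baseLift_toFibre]
    exact hx
  · rintro ⟨q, hq⟩
    obtain ⟨x, hx⟩ := toFibre_surjective π hsec hker θ hθ hs q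
    have hφx : φ x = 0 := by
      rw [← ctrl_baseLift_toFibre π hsec hvan hker θ hθ φ x, hx]
      exact hq
    refine ⟨⟨Submodule.Quotient.mk x, Submodule.mem_map.2 ⟨x, hφx, rfl⟩⟩, ?_⟩
    simp only [toFibreQ_mk, hx]

include hsec hvan hker hθ in
/-- Finite-defect orbit-form control ⟹ `ch_{O⟦T₁⟧}(Y/(T₂ - u)Y) = ch_{O⟦T₁⟧}(X^{rel,str}_ℓ)`.
[cite: Washington1997, §13.2] -/
theorem fibreCharIdeal_eq_of_baseLift_finite [IsDomain O] [IsDiscreteValuationRing O]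
    (hs : Function.Surjective θ) (φ : X →ₛₗ[θ] Xrs)
    (hk : Finite ((LinearMap.ker φ).map (RingHom.ker θ • (⊤ : Submodule A X)).mkQ))
    (hc : Finite (Xrs ⧸ Submodule.span (PowerSeries O) (Set.range φ))) :
    fibreCharIdeal O u ((PowerSeries (PowerSeries O)) ⊗[A] X) =
      Module.charIdeal (PowerSeries O) Xrs := by
  letI := fibreModule O u ((PowerSeries (PowerSeries O)) ⊗[A] X)
  exact Module.charIdeal_eq_of_arePseudoIsomorphic
    ⟨ctrl π hsec hvan (baseLift π θ hθ φ),
      isPseudoIsomorphism_ctrl_baseLift_of_finite π hsec hvan hker θ hθ hs φ hk hc⟩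

end BaseChange

end Summit.BirchSwinnertonDyer.BirchSwinnertonDyer.Cruxes.TwoVariableEulerSystemDivisibility.SplitsliceCtrl
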